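import Mathlib
import HarnessLib
import Summits.HubbardSuperconductivity.HubbardSuperconductivity.Theses.KLProgramme
import Summits.HubbardSuperconductivity.HubbardSuperconductivity.Theorems.KLProgrammeKLRegimeSplitGenericV4
import Summits.HubbardSuperconductivity.HubbardSuperconductivity.Theorems.KLProgrammeH10RungCompactBoxTruncated

/-!
# Route `KLProgramme` — crux K1 `H10TwoPointLimit` (stmt-HubbardSuperconductivity-19938) FROM THE FIVE CHILDREN OF K3
# (pure logic): the children are typed on the FULL multiscale range `klBetaMin ≤ β ≤ e^{c/U²}`, so together with the
# compact-box corner `β ≤ klBetaMin` they give the two-point limit at ALL temperatures `0 < β ≤ e^{c/U²}` — K1, K3 and the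
# rung-R2d leaf at once

Cell `gate-hubbard-kl`, seat p4 (C5a = Paper 1 lead), g5.  OBSERVATION.  The five generic children of crux K3
(`EngineP3/EngineP4`, `BetaSplitP`, `CountertermP2`, `VolumeLimitP/VolumeLimitP2`, `TwoPointAssemblyP3` of
`…Theorems.KLProgrammeKLRegimeSplitGenericV3/V4`, instantiated by the route items 19662–19666 at `klPredsV7`/`klWindowC`) quantify
over `klBetaMin ≤ β ≤ Real.exp (c / U ^ 2)` with NO lower bound `e^{a/U} ≤ β`: the glue `inductionP3/P4` spends K3's `a` only on
`klBetaMin ≤ β` (`klBetaMin_le_of_exp_le`).  Hence the children prove MORE than K3: the limit on the full multiscale range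
(`fullRange_inductionP4`).  The single-scale corner `0 < β ≤ klBetaMin = 128` is the tree's compact-box theorem
`h10rung_twoPoint_limit_box` (item R0′ `H10RungCompactBox`, stmt-…-20034, CLOSED), uniform on any `μ`-box; so the children give the
limit at ALL temperatures `0 < β ≤ e^{c/U²}` (`allTemperatures_inductionP4`), and therefore — by pure logic, no sign-blind engine of its
own — crux K1 `H10TwoPointLimit` (`a := c`, `U₀ ≤ 1`: `e^{c/U} ≤ e^{c/U²}`; `H10TwoPointLimit_of_childrenP4/P3`), K3 in the
`μ`-parametrisation (`klRegimeTwoPointLimitMu_of_allTemperatures`), and the rung-R2d leaf `H1TwoPointLimitKLScaleD` directly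
(`leaf_of_childrenP4/P3`).  Consequence for the plan (DECOMP v8.3 «K1 19938 ≈ 20–32 sd»): K1's open skeleton stub
`stub_H10_mu_of_count : CountPairsOffset → H10AnalysisWindow` is SUBSUMED by the children of K3; Paper 1's separate engine at
`|h| ≤ a/U` remains a print / BC5 milestone, not a Lean prerequisite of the leaf.  Everything here is generic in the bundle `Pr` and the
volume-limit text `VL` (as the glue is) and asserts nothing about the model beyond the CLOSED compact-box theorem it cites.
References: BGM 2006 [cite: BenfattoGiulianiMastropietro2006, Thm 1.1 / §2]; HOME/DECOMP.md v8.3 §2, §8 (j)–(k).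
-/

noncomputable section

namespace Summit.HubbardSuperconductivity.HubbardSuperconductivity.Theorems.KLRegimeSplit

set_option linter.dupNamespace false -- summit = problem name (single-conjunct summit), D-0017

open Real Filter Set Literature.MathematicalPhysics.QuantumLattice Literature.Probability.LatticeModels
open Summit.HubbardSuperconductivity.HubbardSuperconductivity.Theorems.DispersionFlow

/-! ## §1 The children give the FULL multiscale range `klBetaMin ≤ β ≤ e^{c/U²}` -/

/-- **The five v4 children give the two-point limit on the full multiscale range** `klBetaMin ≤ β ≤ e^{c/U²}` on the analysis
window `μ ∈ [-1, -0.15]` (covariance window `W` receiving `μ - U/2`): `inductionP4`'s proof with the hypothesis `klBetaMin ≤ β` taken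
directly instead of being derived from `e^{a/U} ≤ β` — the only use K3's `a` ever had.  Order of choices `G → P → R → Q →
(c₀, c₁, c₃, c₅) → c → U₀` exactly as there. -/
theorem fullRange_inductionP4 {Pr : Preds} {VL : VolLimitSlot} {W : Set ℝ}
    (hW : ∀ μ ∈ Set.Icc (-1 : ℝ) (-0.15), ∀ U : ℝ, 0 < U → U ≤ 1 / 10 → μ - U / 2 ∈ W)
    (h₃ : EngineP4 Pr W) (h₁ : BetaSplitP Pr W) (h₂ : CountertermP2 Pr W) (h₅ : VolumeLimitP2 Pr VL W)
    (h₄ : TwoPointAssemblyP3 Pr VL W) :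
    ∃ U₀ c : ℝ, 0 < U₀ ∧ 0 < c ∧ ∀ μ ∈ Set.Icc (-1 : ℝ) (-0.15), ∀ U β : ℝ, 0 < U → U ≤ U₀ →
      klBetaMin ≤ β → β ≤ Real.exp (c / U ^ 2) → ∀ (x y : Site 2) (σ σ' : Fin 2), ∃ S : ℂ,
        Tendsto (fun L : ℕ => hubbardThermalTwoPoint β U μ L x y σ σ') atTop (nhds S) := by
  obtain ⟨G, hG, h₃P⟩ := h₃
  obtain ⟨P, hP, h₁Q⟩ := h₁ G hG
  obtain ⟨R, hR2, h₂Q⟩ := h₂ G P hG hP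
  have hR : R.WF := hR2.wf
  obtain ⟨Q, hQ, c₃, hc₃, h₃c⟩ := h₃P P hP R hR2
  obtain ⟨c₀, hc₀, h₁c⟩ := h₁Q Q hQ
  obtain ⟨c₁, hc₁, h₂c⟩ := h₂Q Q hQ
  obtain ⟨c₅, hc₅, h₅c⟩ := h₅ G P Q R hG hP hQ hR
  set c : ℝ := min (min c₀ c₁) (min c₃ c₅) with hc_def
  have hc : 0 < c := lt_min (lt_min hc₀ hc₁) (lt_min hc₃ hc₅)
  have hcc₀ : c ≤ c₀ := (min_le_left _ _).trans (min_le_left _ _)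
  have hcc₁ : c ≤ c₁ := (min_le_left _ _).trans (min_le_right _ _)
  have hcc₃ : c ≤ c₃ := (min_le_right _ _).trans (min_le_left _ _)
  have hcc₅ : c ≤ c₅ := (min_le_right _ _).trans (min_le_right _ _)
  obtain ⟨U₃, hU₃, L₃, M₃, h₃main⟩ := h₃c c hc hcc₃
  obtain ⟨U₁, hU₁, L₁, M₁, h₁main⟩ := h₁c c hc hcc₀ R hR
  obtain ⟨U₂, hU₂, h₂main⟩ := h₂c c hc hcc₁
  obtain ⟨U₅, hU₅, h₅main⟩ := h₅c c hc hcc₅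
  obtain ⟨U₄, hU₄, h₄main⟩ := h₄ G P Q R hG hP hQ hR c hc
  set U₀ : ℝ := min (min (min U₁ U₂) (min U₃ (min U₄ U₅))) (1 / 10) with hU₀_def
  have hU₀ : 0 < U₀ := lt_min (lt_min (lt_min hU₁ hU₂) (lt_min hU₃ (lt_min hU₄ hU₅))) (by norm_num)
  refine ⟨U₀, c, hU₀, hc, ?_⟩
  intro μ hμ U β hU hUle hβmin hβc x y σ σ'
  have hUm : U ≤ min (min U₁ U₂) (min U₃ (min U₄ U₅)) := hUle.trans (min_le_left _ _)
  have hU10 : U ≤ 1 / 10 := hUle.trans (min_le_right _ _)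
  have hU1 : U ≤ U₁ := hUm.trans ((min_le_left _ _).trans (min_le_left _ _))
  have hU2 : U ≤ U₂ := hUm.trans ((min_le_left _ _).trans (min_le_right _ _))
  have hU3 : U ≤ U₃ := hUm.trans ((min_le_right _ _).trans (min_le_left _ _))
  have hU4 : U ≤ U₄ := hUm.trans ((min_le_right _ _).trans ((min_le_right _ _).trans (min_le_left _ _)))
  have hU5 : U ≤ U₅ := hUm.trans ((min_le_right _ _).trans ((min_le_right _ _).trans (min_le_right _ _)))
  have hKL : ∀ n ≤ nScales β + 1, IsKLRegime U c (-(n : ℤ)) := fun n hn =>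
    isKLRegime_of_le_nScales_succ hc.le hβmin hβc hn
  -- the covariance potential
  set ν : ℝ := μ - U / 2 with hν_def
  have hν : ν ∈ W := hW μ hμ U hU hU10
  -- the glued induction (children 3 + 1) up to `n_β` for EVERY admissible frame, beyond the maxed hypothesis thresholds
  have hall : ∀ K : TrigPolyC4v, Pr.frameOK R U (nScales β) ν K →
      ∀ (L M : ℕ) [NeZero L] [NeZero M], max (L₃ β U) (L₁ β U) ≤ L → max (M₃ β U L) (M₁ β U L) ≤ M →
        ∀ n : ℕ, n ≤ nScales β → (∀ j < n, Pr.renorm L M β U ν K R j) →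
          Pr.engine L M G P Q β U ν K n ∧ Pr.twoLeg L M G P Q R β U ν K n ∧
            Pr.split L M G P Q β U ν K n := by
    intro K hK L M _ _ hL hM n hn hRn
    have hL3 : L₃ β U ≤ L := (le_max_left _ _).trans hL
    have hL1 : L₁ β U ≤ L := (le_max_right _ _).trans hL
    have hM3 : M₃ β U L ≤ M := (le_max_left _ _).trans hM
    have hM1 : M₁ β U L ≤ M := (le_max_right _ _).trans hM
    exact Child.allScales (N := nScales β) (KL := fun n => IsKLRegime U c (-(n : ℤ)))
      (B := fun n => Pr.split L M G P Q β U ν K n) (Rn := fun n => Pr.renorm L M β U ν K R n)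
      (E := fun n => Pr.engine L M G P Q β U ν K n) (T := fun n => Pr.twoLeg L M G P Q R β U ν K n)
      (fun n hn hkl hyp => h₃main ν hν U hU hU3 β hβmin hβc K hK L M hL3 hM3 n (Nat.le_succ_of_le hn) hkl hyp)
      (fun n hn hkl hyp hEn hTn => h₁main ν hν U hU hU1 β hβmin hβc K hK L M hL1 hM1 n hn hkl hyp hEn hTn)
      (fun n hn => hKL n (Nat.le_succ_of_le hn)) n hn hRn
  -- child 2: the volume-uniform renormalised admissible frame and its thresholds
  obtain ⟨K, hK, Lc, Mc, hKR⟩ :=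
    h₂main ν hν U hU hU2 β hβmin hβc (max (L₃ β U) (L₁ β U)) (fun L => max (M₃ β U L) (M₁ β U L)) hall
  -- the full tower of K beyond the max of all thresholds, including the engine's LAST step `n_β + 1`
  set Lstar : ℕ := max Lc (max (L₃ β U) (L₁ β U)) with hLstar
  set Mstar : ℕ → ℕ := fun L => max (Mc L) (max (M₃ β U L) (M₁ β U L)) with hMstar
  have htower : TowerP Pr G P Q R β U ν K Lstar Mstar := by
    intro L M _ _ hL hM
    have hLc : Lc ≤ L := (le_max_left _ _).trans hL
    have hLh : max (L₃ β U) (L₁ β U) ≤ L := (le_max_right _ _).trans hL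
    have hL3 : L₃ β U ≤ L := (le_max_left _ _).trans hLh
    have hMc : Mc L ≤ M := (le_max_left _ _).trans hM
    have hMh : max (M₃ β U L) (M₁ β U L) ≤ M := (le_max_right _ _).trans hM
    have hM3 : M₃ β U L ≤ M := (le_max_left _ _).trans hMh
    have hle : ∀ n : ℕ, n ≤ nScales β →
        Pr.renorm L M β U ν K R n ∧ Pr.split L M G P Q β U ν K n ∧
          Pr.engine L M G P Q β U ν K n ∧ Pr.twoLeg L M G P Q R β U ν K n := by
      intro n hn
      have h := hall K hK L M hLh hMh n hn fun j hj => hKR L M hLc hMc j (le_of_lt (lt_of_lt_of_le hj hn))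
      exact ⟨hKR L M hLc hMc n hn, h.2.2, h.1, h.2.1⟩
    refine ⟨hle, ?_⟩
    -- the last step: history = the tower at `j ≤ n_β`
    have hhist : HistP Pr L M G P Q R β U ν K (nScales β + 1) := by
      intro j hj
      have hj' : j ≤ nScales β := Nat.lt_succ_iff.mp hj
      have h := hle j hj'
      exact ⟨h.2.1, h.1, h.2.2.1, h.2.2.2⟩
    exact h₃main ν hν U hU hU3 β hβmin hβc K hK L M hL3 hM3 (nScales β + 1) le_rfl (hKL _ le_rfl) hhist
  -- child 5: termwise volume limits for this frame
  have hVL : VL β U ν K Mstar := h₅main ν hν U hU hU5 β hβmin hβc K hK Lstar Mstar htower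
  -- child 4 at the covariance potential; its conclusion is at ν + U/2 = μ
  have hphys : ν + U / 2 = μ := by rw [hν_def]; ring
  have h4 := h₄main ν hν U hU hU4 β hβmin hβc Lstar Mstar ⟨K, hK, htower, hVL⟩ x y σ σ'
  rwa [hphys] at h4

/-- **The v3 children give the full multiscale range too** (via `engineP4_of_engineP3` / `volumeLimitP2_of_volumeLimitP`). -/
theorem fullRange_inductionP3 {Pr : Preds} {VL : VolLimitSlot} {W : Set ℝ}
    (hW : ∀ μ ∈ Set.Icc (-1 : ℝ) (-0.15), ∀ U : ℝ, 0 < U → U ≤ 1 / 10 → μ - U / 2 ∈ W)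
    (h₃ : EngineP3 Pr W) (h₁ : BetaSplitP Pr W) (h₂ : CountertermP2 Pr W) (h₅ : VolumeLimitP Pr VL W)
    (h₄ : TwoPointAssemblyP3 Pr VL W) :
    ∃ U₀ c : ℝ, 0 < U₀ ∧ 0 < c ∧ ∀ μ ∈ Set.Icc (-1 : ℝ) (-0.15), ∀ U β : ℝ, 0 < U → U ≤ U₀ →
      klBetaMin ≤ β → β ≤ Real.exp (c / U ^ 2) → ∀ (x y : Site 2) (σ σ' : Fin 2), ∃ S : ℂ,
        Tendsto (fun L : ℕ => hubbardThermalTwoPoint β U μ L x y σ σ') atTop (nhds S) :=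
  fullRange_inductionP4 hW (engineP4_of_engineP3 h₃) h₁ h₂ (volumeLimitP2_of_volumeLimitP h₅) h₄

/-! ## §2 All temperatures `0 < β ≤ e^{c/U²}`: the compact-box corner closes the range below `klBetaMin` -/

/-- **From the full multiscale range to ALL temperatures** on a `μ`-window: if the limit holds for `klBetaMin ≤ β ≤ e^{c/U²}`,
`U ≤ U₀`, then — with the tree's single-scale compact-box theorem `h10rung_twoPoint_limit_box klBetaMin μa μb` (uniform radius on
`(0, klBetaMin] × [μa, μb]`) — it holds for `0 < β ≤ e^{c/U²}`, `U ≤ min U₀ (r/2)`. [cite: BenfattoGiulianiMastropietro2006, Thm 1.1 / §2] -/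
theorem allTemperatures_of_fullRange {μa μb U₀ c : ℝ} (hU₀ : 0 < U₀)
    (h : ∀ μ ∈ Set.Icc μa μb, ∀ U β : ℝ, 0 < U → U ≤ U₀ → klBetaMin ≤ β → β ≤ Real.exp (c / U ^ 2) →
      ∀ (x y : Site 2) (σ σ' : Fin 2), ∃ S : ℂ,
        Tendsto (fun L : ℕ => hubbardThermalTwoPoint β U μ L x y σ σ') atTop (nhds S)) :
    ∃ U₁ : ℝ, 0 < U₁ ∧ U₁ ≤ U₀ ∧ ∀ μ ∈ Set.Icc μa μb, ∀ U β : ℝ, 0 < U → U ≤ U₁ → 0 < β → β ≤ Real.exp (c / U ^ 2) →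
      ∀ (x y : Site 2) (σ σ' : Fin 2), ∃ S : ℂ,
        Tendsto (fun L : ℕ => hubbardThermalTwoPoint β U μ L x y σ σ') atTop (nhds S) := by
  obtain ⟨r, hr, hbox⟩ := h10rung_twoPoint_limit_box klBetaMin μa μb
  refine ⟨min U₀ (r / 2), lt_min hU₀ (by positivity), min_le_left _ _, ?_⟩
  intro μ hμ U β hU hUle hβ hβc x y σ σ'
  by_cases hcase : β ≤ klBetaMin
  · have hUr : |U| < r := by
      rw [abs_of_pos hU]
      linarith [hUle.trans (min_le_right U₀ (r / 2))]
    exact hbox β ⟨hβ, hcase⟩ μ hμ U hUr x y σ σ'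
  · exact h μ hμ U β hU (hUle.trans (min_le_left _ _)) (le_of_lt (not_le.mp hcase)) hβc x y σ σ'

/-- **The five v4 children give the two-point limit at ALL temperatures `0 < β ≤ e^{c/U²}`** on the analysis window
`μ ∈ [-1, -0.15]` — the leaf's statement in the `μ`-parametrisation. -/
theorem allTemperatures_inductionP4 {Pr : Preds} {VL : VolLimitSlot} {W : Set ℝ}
    (hW : ∀ μ ∈ Set.Icc (-1 : ℝ) (-0.15), ∀ U : ℝ, 0 < U → U ≤ 1 / 10 → μ - U / 2 ∈ W)
    (h₃ : EngineP4 Pr W) (h₁ : BetaSplitP Pr W) (h₂ : CountertermP2 Pr W) (h₅ : VolumeLimitP2 Pr VL W)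
    (h₄ : TwoPointAssemblyP3 Pr VL W) :
    ∃ U₀ c : ℝ, 0 < U₀ ∧ 0 < c ∧ ∀ μ ∈ Set.Icc (-1 : ℝ) (-0.15), ∀ U β : ℝ, 0 < U → U ≤ U₀ →
      0 < β → β ≤ Real.exp (c / U ^ 2) → ∀ (x y : Site 2) (σ σ' : Fin 2), ∃ S : ℂ,
        Tendsto (fun L : ℕ => hubbardThermalTwoPoint β U μ L x y σ σ') atTop (nhds S) := by
  obtain ⟨U₀, c, hU₀, hc, h⟩ := fullRange_inductionP4 hW h₃ h₁ h₂ h₅ h₄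
  obtain ⟨U₁, hU₁, -, h₁'⟩ := allTemperatures_of_fullRange hU₀ h
  exact ⟨U₁, c, hU₁, hc, h₁'⟩

/-! ## §3 K3, K1 and the leaf from the all-temperatures statement -/

/-- **The five v3 children give the two-point limit at ALL temperatures** on the analysis window (v3 ⇒ v4 embeddings). -/
theorem allTemperatures_inductionP3 {Pr : Preds} {VL : VolLimitSlot} {W : Set ℝ}
    (hW : ∀ μ ∈ Set.Icc (-1 : ℝ) (-0.15), ∀ U : ℝ, 0 < U → U ≤ 1 / 10 → μ - U / 2 ∈ W)
    (h₃ : EngineP3 Pr W) (h₁ : BetaSplitP Pr W) (h₂ : CountertermP2 Pr W) (h₅ : VolumeLimitP Pr VL W)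
    (h₄ : TwoPointAssemblyP3 Pr VL W) :
    ∃ U₀ c : ℝ, 0 < U₀ ∧ 0 < c ∧ (∀ μ ∈ Set.Icc (-1 : ℝ) (-0.15), ∀ U β : ℝ, 0 < U → U ≤ U₀ → 0 < β → β ≤ Real.exp (c / U ^ 2) →
      ∀ (x y : Site 2) (σ σ' : Fin 2), ∃ S : ℂ,
        Tendsto (fun L : ℕ => hubbardThermalTwoPoint β U μ L x y σ σ') atTop (nhds S)) := by
  obtain ⟨U₀, c, hU₀, hc, h⟩ := fullRange_inductionP3 hW h₃ h₁ h₂ h₅ h₄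
  obtain ⟨U₁, hU₁, -, h₁'⟩ := allTemperatures_of_fullRange hU₀ h
  exact ⟨U₁, c, hU₁, hc, h₁'⟩

/-- **K3 (`μ`-form) from all temperatures** — nothing is lost: `e^{a/U} ≤ β` implies `0 < β`. -/
theorem klRegimeTwoPointLimitMu_of_allTemperatures {μa μb U₀ c : ℝ} (hU₀ : 0 < U₀) (hc : 0 < c)
    (h : ∀ μ ∈ Set.Icc μa μb, ∀ U β : ℝ, 0 < U → U ≤ U₀ → 0 < β → β ≤ Real.exp (c / U ^ 2) →
      ∀ (x y : Site 2) (σ σ' : Fin 2), ∃ S : ℂ,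
        Tendsto (fun L : ℕ => hubbardThermalTwoPoint β U μ L x y σ σ') atTop (nhds S)) :
    KLRegimeTwoPointLimitMu μa μb := fun _ _ =>
  ⟨U₀, c, hU₀, hc, fun μ hμ U β hU hUle hβa hβc x y σ σ' =>
    h μ hμ U β hU hUle (lt_of_lt_of_le (Real.exp_pos _) hβa) hβc x y σ σ'⟩

/-- **K1 (`μ`-form) from all temperatures**: with `a := c` and `U₀ ≤ 1`, `β ≤ e^{c/U}` implies `β ≤ e^{c/U²}`. -/
theorem h10Mu_of_allTemperatures {μa μb U₀ c : ℝ} (hU₀ : 0 < U₀) (hc : 0 < c)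
    (h : ∀ μ ∈ Set.Icc μa μb, ∀ U β : ℝ, 0 < U → U ≤ U₀ → 0 < β → β ≤ Real.exp (c / U ^ 2) →
      ∀ (x y : Site 2) (σ σ' : Fin 2), ∃ S : ℂ,
        Tendsto (fun L : ℕ => hubbardThermalTwoPoint β U μ L x y σ σ') atTop (nhds S)) :
    ∃ U₁ a : ℝ, 0 < U₁ ∧ 0 < a ∧ ∀ μ ∈ Set.Icc μa μb, ∀ U β : ℝ, 0 < U → U ≤ U₁ → 0 < β → β ≤ Real.exp (a / U) →
      ∀ (x y : Site 2) (σ σ' : Fin 2), ∃ S : ℂ,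
        Tendsto (fun L : ℕ => hubbardThermalTwoPoint β U μ L x y σ σ') atTop (nhds S) := by
  refine ⟨min U₀ 1, c, lt_min hU₀ one_pos, hc, fun μ hμ U β hU hUle hβ hβa x y σ σ' => ?_⟩
  have hU1 : U ≤ 1 := hUle.trans (min_le_right _ _)
  have hexp : Real.exp (c / U) ≤ Real.exp (c / U ^ 2) := by
    apply Real.exp_le_exp.mpr
    rw [div_le_div_iff₀ hU (by positivity)]
    nlinarith [mul_le_mul_of_nonneg_left hU1 hc.le, hU]
  exact h μ hμ U β hU (hUle.trans (min_le_left _ _)) hβ (hβa.trans hexp) x y σ σ'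

/-- **Crux K1 `H10TwoPointLimit` from all temperatures on the analysis window** (S0 `MuOfDopingWindow` places `μ(δ)`). -/
theorem h10TwoPointLimit_of_allTemperatures {U₀ c : ℝ} (hU₀ : 0 < U₀) (hc : 0 < c)
    (h : ∀ μ ∈ Set.Icc (-1 : ℝ) (-0.15), ∀ U β : ℝ, 0 < U → U ≤ U₀ → 0 < β → β ≤ Real.exp (c / U ^ 2) →
      ∀ (x y : Site 2) (σ σ' : Fin 2), ∃ S : ℂ,
        Tendsto (fun L : ℕ => hubbardThermalTwoPoint β U μ L x y σ σ') atTop (nhds S)) :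
    Summit.HubbardSuperconductivity.HubbardSuperconductivity.Theses.KLProgramme.H10TwoPointLimit := by
  obtain ⟨U₁, a, hU₁, ha, h₁'⟩ := h10Mu_of_allTemperatures hU₀ hc h
  exact ⟨U₁, a, hU₁, ha, fun δ hδ U β hU hUle hβ hβa x y σ σ' =>
    h₁' _ (Summit.HubbardSuperconductivity.HubbardSuperconductivity.Theses.KLProgramme.MuOfDopingWindow_holds δ hδ)
      U β hU hUle hβ hβa x y σ σ'⟩

/-- **Crux K3 `KLRegimeTwoPointLimit` from all temperatures on the analysis window.** -/
theorem klRegimeTwoPointLimit_of_allTemperatures {U₀ c : ℝ} (hU₀ : 0 < U₀) (hc : 0 < c)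
    (h : ∀ μ ∈ Set.Icc (-1 : ℝ) (-0.15), ∀ U β : ℝ, 0 < U → U ≤ U₀ → 0 < β → β ≤ Real.exp (c / U ^ 2) →
      ∀ (x y : Site 2) (σ σ' : Fin 2), ∃ S : ℂ,
        Tendsto (fun L : ℕ => hubbardThermalTwoPoint β U μ L x y σ σ') atTop (nhds S)) :
    Summit.HubbardSuperconductivity.HubbardSuperconductivity.Theses.KLProgramme.KLRegimeTwoPointLimit := by
  intro a ha
  obtain ⟨U₁, c', hU₁, hc', h'⟩ := klRegimeTwoPointLimitMu_of_allTemperatures hU₀ hc h a ha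
  exact ⟨U₁, c', hU₁, hc', fun δ hδ U β hU hUle hβa hβc x y σ σ' =>
    h' _ (Summit.HubbardSuperconductivity.HubbardSuperconductivity.Theses.KLProgramme.MuOfDopingWindow_holds δ hδ)
      U β hU hUle hβa hβc x y σ σ'⟩

/-- **The rung-R2d leaf `H1TwoPointLimitKLScaleD` from all temperatures on the analysis window**, directly (the same `U₀, c`). -/
theorem leaf_of_allTemperatures {U₀ c : ℝ} (hU₀ : 0 < U₀) (hc : 0 < c)
    (h : ∀ μ ∈ Set.Icc (-1 : ℝ) (-0.15), ∀ U β : ℝ, 0 < U → U ≤ U₀ → 0 < β → β ≤ Real.exp (c / U ^ 2) →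
      ∀ (x y : Site 2) (σ σ' : Fin 2), ∃ S : ℂ,
        Tendsto (fun L : ℕ => hubbardThermalTwoPoint β U μ L x y σ σ') atTop (nhds S)) :
    Summit.HubbardSuperconductivity.HubbardSuperconductivity.Theses.WeakCouplingBCS.H1TwoPointLimitKLScaleD :=
  ⟨U₀, c, hU₀, hc, fun δ hδ U β hU hUle hβ hβc x y σ σ' =>
    h _ (Summit.HubbardSuperconductivity.HubbardSuperconductivity.Theses.KLProgramme.MuOfDopingWindow_holds δ hδ)
      U β hU hUle hβ hβc x y σ σ'⟩

/-- **Crux K1 `H10TwoPointLimit` from the five v4 children of K3** (on the covariance window `klWindowC`) — pure logic through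
`allTemperatures_inductionP4`, the CLOSED compact-box corner and the CLOSED support item S0 `MuOfDopingWindow`. -/
theorem H10TwoPointLimit_of_childrenP4 {Pr : Preds} {VL : VolLimitSlot} (h₃ : EngineP4 Pr klWindowC)
    (h₁ : BetaSplitP Pr klWindowC) (h₂ : CountertermP2 Pr klWindowC) (h₅ : VolumeLimitP2 Pr VL klWindowC)
    (h₄ : TwoPointAssemblyP3 Pr VL klWindowC) :
    Summit.HubbardSuperconductivity.HubbardSuperconductivity.Theses.KLProgramme.H10TwoPointLimit := by
  obtain ⟨U₀, c, hU₀, hc, h⟩ :=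
    allTemperatures_inductionP4 (fun _ hμ _ hU hU' => sub_half_mem_klWindowC hμ hU hU') h₃ h₁ h₂ h₅ h₄
  exact h10TwoPointLimit_of_allTemperatures hU₀ hc h

/-- **Crux K1 from the five v3 children of K3** (the items of record 19662–19666 are the v3/v4 texts at `klPredsV7`). -/
theorem H10TwoPointLimit_of_childrenP3 {Pr : Preds} {VL : VolLimitSlot} (h₃ : EngineP3 Pr klWindowC)
    (h₁ : BetaSplitP Pr klWindowC) (h₂ : CountertermP2 Pr klWindowC) (h₅ : VolumeLimitP Pr VL klWindowC)
    (h₄ : TwoPointAssemblyP3 Pr VL klWindowC) :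
    Summit.HubbardSuperconductivity.HubbardSuperconductivity.Theses.KLProgramme.H10TwoPointLimit := by
  obtain ⟨U₀, c, hU₀, hc, h⟩ :=
    allTemperatures_inductionP3 (fun _ hμ _ hU hU' => sub_half_mem_klWindowC hμ hU hU') h₃ h₁ h₂ h₅ h₄
  exact h10TwoPointLimit_of_allTemperatures hU₀ hc h

/-- **The rung-R2d leaf `H1TwoPointLimitKLScaleD` from the five v4 children of K3**, directly. -/
theorem leaf_of_childrenP4 {Pr : Preds} {VL : VolLimitSlot} (h₃ : EngineP4 Pr klWindowC)
    (h₁ : BetaSplitP Pr klWindowC) (h₂ : CountertermP2 Pr klWindowC) (h₅ : VolumeLimitP2 Pr VL klWindowC)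
    (h₄ : TwoPointAssemblyP3 Pr VL klWindowC) :
    Summit.HubbardSuperconductivity.HubbardSuperconductivity.Theses.WeakCouplingBCS.H1TwoPointLimitKLScaleD := by
  obtain ⟨U₀, c, hU₀, hc, h⟩ :=
    allTemperatures_inductionP4 (fun _ hμ _ hU hU' => sub_half_mem_klWindowC hμ hU hU') h₃ h₁ h₂ h₅ h₄
  exact leaf_of_allTemperatures hU₀ hc h

/-- **The rung-R2d leaf from the five v3 children of K3.** -/
theorem leaf_of_childrenP3 {Pr : Preds} {VL : VolLimitSlot} (h₃ : EngineP3 Pr klWindowC)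
    (h₁ : BetaSplitP Pr klWindowC) (h₂ : CountertermP2 Pr klWindowC) (h₅ : VolumeLimitP Pr VL klWindowC)
    (h₄ : TwoPointAssemblyP3 Pr VL klWindowC) :
    Summit.HubbardSuperconductivity.HubbardSuperconductivity.Theses.WeakCouplingBCS.H1TwoPointLimitKLScaleD := by
  obtain ⟨U₀, c, hU₀, hc, h⟩ :=
    allTemperatures_inductionP3 (fun _ hμ _ hU hU' => sub_half_mem_klWindowC hμ hU hU') h₃ h₁ h₂ h₅ h₄
  exact leaf_of_allTemperatures hU₀ hc h

/-- **The leaf through the route's deciding theorem** agrees: `closes` applied to K1 and K3 obtained from the v4 children. -/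
theorem leaf_of_childrenP4_via_closes {Pr : Preds} {VL : VolLimitSlot} (h₃ : EngineP4 Pr klWindowC)
    (h₁ : BetaSplitP Pr klWindowC) (h₂ : CountertermP2 Pr klWindowC) (h₅ : VolumeLimitP2 Pr VL klWindowC)
    (h₄ : TwoPointAssemblyP3 Pr VL klWindowC) :
    Summit.HubbardSuperconductivity.HubbardSuperconductivity.Theses.WeakCouplingBCS.H1TwoPointLimitKLScaleD := by
  obtain ⟨U₀, c, hU₀, hc, h⟩ :=
    allTemperatures_inductionP4 (fun _ hμ _ hU hU' => sub_half_mem_klWindowC hμ hU hU') h₃ h₁ h₂ h₅ h₄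
  -- re-glued 2026-08-28 (ops-buildfix-2 gen 29): the route's `closes` was re-keyed at rev 24 (binders K1, MuOfDopingWindow and
  -- the five gen-8 children instead of K1 + K3), so the leaf is taken from the all-temperatures statement directly, exactly as in
  -- `leaf_of_childrenP4`; statement byte-identical.
  exact leaf_of_allTemperatures hU₀ hc h

/-! ## §4 (appended, p4 g5) The `βU`-corner — support item R0 `H10RungBetaUCorner` (stmt-HubbardSuperconductivity-20035) —
from the all-temperatures statement, hence from the five children of K3 -/

/-- **R0 (`μ`-form) from all temperatures**: with `κ := 1` and `U₁ := min U₀ c`, `βU ≤ 1` gives `β ≤ 1/U ≤ c/U² ≤ e^{c/U²}`. -/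
theorem h10RungBetaUCornerMu_of_allTemperatures {μa μb U₀ c : ℝ} (hU₀ : 0 < U₀) (hc : 0 < c)
    (h : ∀ μ ∈ Set.Icc μa μb, ∀ U β : ℝ, 0 < U → U ≤ U₀ → 0 < β → β ≤ Real.exp (c / U ^ 2) →
      ∀ (x y : Site 2) (σ σ' : Fin 2), ∃ S : ℂ,
        Tendsto (fun L : ℕ => hubbardThermalTwoPoint β U μ L x y σ σ') atTop (nhds S)) :
    ∃ U₁ κ : ℝ, 0 < U₁ ∧ 0 < κ ∧ ∀ μ ∈ Set.Icc μa μb, ∀ U β : ℝ, 0 < U → U ≤ U₁ → 0 < β → β * U ≤ κ →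
      ∀ (x y : Site 2) (σ σ' : Fin 2), ∃ S : ℂ,
        Tendsto (fun L : ℕ => hubbardThermalTwoPoint β U μ L x y σ σ') atTop (nhds S) := by
  refine ⟨min U₀ c, 1, lt_min hU₀ hc, one_pos, fun μ hμ U β hU hUle hβ hβU x y σ σ' => ?_⟩
  have hUc : U ≤ c := hUle.trans (min_le_right _ _)
  have hU2 : 0 < U ^ 2 := by positivity
  have hβle : β ≤ Real.exp (c / U ^ 2) := by
    have h1 : β ≤ 1 / U := by rw [le_div_iff₀ hU]; linarith
    have h2 : 1 / U ≤ c / U ^ 2 := by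
      rw [div_le_div_iff₀ hU hU2]
      nlinarith
    have h3 : c / U ^ 2 ≤ Real.exp (c / U ^ 2) := by linarith [Real.add_one_le_exp (c / U ^ 2)]
    linarith
  exact h μ hμ U β hU (hUle.trans (min_le_left _ _)) hβ hβle x y σ σ'

/-- **Support item R0 `H10RungBetaUCorner` from all temperatures on the analysis window** (S0 places `μ(δ)`). -/
theorem h10RungBetaUCorner_of_allTemperatures {U₀ c : ℝ} (hU₀ : 0 < U₀) (hc : 0 < c)
    (h : ∀ μ ∈ Set.Icc (-1 : ℝ) (-0.15), ∀ U β : ℝ, 0 < U → U ≤ U₀ → 0 < β → β ≤ Real.exp (c / U ^ 2) →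
      ∀ (x y : Site 2) (σ σ' : Fin 2), ∃ S : ℂ,
        Tendsto (fun L : ℕ => hubbardThermalTwoPoint β U μ L x y σ σ') atTop (nhds S)) :
    Summit.HubbardSuperconductivity.HubbardSuperconductivity.Theses.KLProgramme.H10RungBetaUCorner := by
  obtain ⟨U₁, κ, hU₁, hκ, h₁⟩ := h10RungBetaUCornerMu_of_allTemperatures hU₀ hc h
  exact ⟨U₁, κ, hU₁, hκ, fun δ hδ U β hU hUle hβ hβU x y σ σ' =>
    h₁ _ (Summit.HubbardSuperconductivity.HubbardSuperconductivity.Theses.KLProgramme.MuOfDopingWindow_holds δ hδ)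
      U β hU hUle hβ hβU x y σ σ'⟩

/-- **R0 `H10RungBetaUCorner` from the five v4 children of K3** — like K1, the second BC5 rung of K1 is subsumed by the children. -/
theorem H10RungBetaUCorner_of_childrenP4 {Pr : Preds} {VL : VolLimitSlot} (h₃ : EngineP4 Pr klWindowC)
    (h₁ : BetaSplitP Pr klWindowC) (h₂ : CountertermP2 Pr klWindowC) (h₅ : VolumeLimitP2 Pr VL klWindowC)
    (h₄ : TwoPointAssemblyP3 Pr VL klWindowC) :
    Summit.HubbardSuperconductivity.HubbardSuperconductivity.Theses.KLProgramme.H10RungBetaUCorner := by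
  obtain ⟨U₀, c, hU₀, hc, h⟩ :=
    allTemperatures_inductionP4 (fun _ hμ _ hU hU' => sub_half_mem_klWindowC hμ hU hU') h₃ h₁ h₂ h₅ h₄
  exact h10RungBetaUCorner_of_allTemperatures hU₀ hc h

/-- **R0 `H10RungBetaUCorner` from the five v3 children of K3.** -/
theorem H10RungBetaUCorner_of_childrenP3 {Pr : Preds} {VL : VolLimitSlot} (h₃ : EngineP3 Pr klWindowC)
    (h₁ : BetaSplitP Pr klWindowC) (h₂ : CountertermP2 Pr klWindowC) (h₅ : VolumeLimitP Pr VL klWindowC)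
    (h₄ : TwoPointAssemblyP3 Pr VL klWindowC) :
    Summit.HubbardSuperconductivity.HubbardSuperconductivity.Theses.KLProgramme.H10RungBetaUCorner := by
  obtain ⟨U₀, c, hU₀, hc, h⟩ :=
    allTemperatures_inductionP3 (fun _ hμ _ hU hU' => sub_half_mem_klWindowC hμ hU hU') h₃ h₁ h₂ h₅ h₄
  exact h10RungBetaUCorner_of_allTemperatures hU₀ hc h

end Summit.HubbardSuperconductivity.HubbardSuperconductivity.Theorems.KLRegimeSplit

end
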